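import Summits.AtomisticToContinuum.FouriersLaw.Theses.CoercivePulse
import Summits.AtomisticToContinuum.FouriersLaw.Theorems.EmbeddedDrudeMourreAbelThermodynamicLimitKaramataRieszTwo

/-!
# Birth skeleton (BC3) — crux `PulseCalculus` (stmt-AtomisticToContinuum-15385)

Route `route-AtomisticToContinuum-CoercivePulse`, sub-problem `AtomisticToContinuum/FouriersLaw`, crux
`Summit.AtomisticToContinuum.FouriersLaw.Theses.CoercivePulse.PulseCalculus` (rank 9, intended 6; registrar
`planner-skel-stmt-AtomisticToContinuum-15385-0`, skeleton-register one-shot, 2026-08-17).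

THE CRUX (fixed, concluded BY NAME below) — INFINITE-VOLUME CALCULUS OF THE EQUILIBRIUM ENERGY PULSE: under the
guard Γ (pinnedChain `ω₂, lam, β > 0`; `T > 0`; `μ` a shift- and momentum-reversal-invariant DLR Gibbs state; `D` a
`μ`-preserving, a.e. shift-covariant infinite-volume dynamics; `h` = split-bond site energy; `S(x,t) = Cov(h_0, h_x∘φ_t)`;
`M(t) = Σ_x x² S(x,t)`; `C_T = D.currentCorrelation μ`) the five conjuncts
(1) `∀ t, D.HasAbsConvergentCorrelation μ t`; (2) `∀ ν > 0, e^{−νt} C_T ∈ L¹(0,∞)`; (3) `∀ t, Σ_x (1+x²)|S(x,t)| < ∞`;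
(4) `M` continuous; (5) `∀ ν > 0`, `e^{−νt}(M(t)−M(0)) ∈ L¹(0,∞)` and `∫₀^∞ e^{−νt} C_T = (ν²/2) ∫₀^∞ e^{−νt}(M(t)−M(0))`.

THE LINE = the crux's own announced decomposition ("light cone; clustering; local Helfand identity; Laplace transform
by Fubini"), cut at its three genuine seams, with the pure real analysis PROVED here:

* **S1 `stub_currentRegularity`** (L) — current side: (1) + `C_T` continuous and bounded (ℓ¹ space–time clustering of
  current–current correlations; in tree for the canonical Buttà–Marchioro pair, open in the guard's generality).
* **S2 `stub_pulseRegularity`** (L–XL, LOAD-BEARING) — energy side: (3) + (4) (x²-weighted light cone + Gibbs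
  clustering for the energy–energy correlation; continuity of the Helfand moment).
* **S3 `stub_helfandIdentity`** (L) — given S1's and S2's conclusions, the LOCAL Einstein–Helfand identity
  `M(t) − M(0) = 2∫₀ᵗ(t−u)C_T(u)du` (`t > 0`): `ḣ_x = j_{x−1} − j_x`, `M′ = Σ(2x+1)F`, `M″ = 2C_T` by stationarity +
  shift covariance, `M′(0) = 0` by momentum reversal.
* GLUE (proved, §3): (2) from bounded + measurable `C_T` (`integrableOn_exp_neg_mul_of_bounded`); (5) from the local
  identity by Fubini on the triangle — the LANDED theorem
  `Theorems.AbelThermodynamicLimit.LoomisCompactHorizonWitness.laplace_doubleIntegral`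
  (`ν² ∫₀^∞ e^{−νt} ∫₀ᵗ(t−u)C = ∫₀^∞ e^{−νt} C`, Theorems/EmbeddedDrudeMourreAbelThermodynamicLimitKaramataRieszTwo.lean,
  sorry-free) wrapped as `laplace_of_helfand`.
* **`PulseCalculus_of : Sig.stub_currentRegularity → Sig.stub_pulseRegularity → Sig.stub_helfandIdentity → PulseCalculus`**
  (kernel-checked, no sorry; the unique declaration of this file concluding the crux, BY NAME).

File map: §1 `Sig.stub_<name> : Prop` — the stub STATEMENTS, named so that the composition's hypotheses are the
declared stubs BY NAME (generated from one source string per stub by the registrar's `gen_birth.py`; identity with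
the stub types is checked definitionally by the `example`s of §2); §2 `theorem stub_<name> : <statement verbatim> :=
by sorry` — the registered stubs, the ONLY sorries; §3 the proved glue; §4 `PulseCalculus_of`; §5 an `example`
instantiating it through the sorried stubs (registers nothing).

Hardest stub: S2 (grounder g46-3 on the item: conjuncts 1–2 and the unweighted half of 3 are in tree for the canonical
pair; "what remains genuinely unproved is exactly the x²-WEIGHT in conjunct 3, continuity of M, and the local Helfand
identity"). Harmonic calibration (`lam = β = 0`, outside the guard): S1–S3 and the crux all HOLD there (explicit
Gaussian/Bessel kernels, `M ≈ 0.19t²`) — this crux is the de-vacuifier of the route, not where anharmonicity enters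
(that is LinearSpread / LinearCeiling).

Disproof used: none exists — `ledger crux ls stmt-AtomisticToContinuum-15385` lists no workfiles (no `Disproof.lean`,
no `Negative/` lemma, no crux ideas) at registration; nothing to honour or avoid yet. Negatives index (20 refuted
statements of the summit, 2 on FouriersLaw): `not_OddCorrectorDecay` (stmt-9139: N-UNIFORM `L¹_t` decay of the odd
sector of the finite thermostatted chain — no stub here asks any decay RATE or N-uniformity; S1 asks boundedness and
continuity of the infinite-volume equilibrium `C_T`, S2 fixed-time spatial summability) and
`DiluteCellGaussianiserFarFieldGaussianity_refuted` (stmt-12890, another model) — no stub is an instance of either.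
-/

namespace Summit.AtomisticToContinuum.FouriersLaw.Cruxes.PulseCalculus.Birth

open MeasureTheory Filter Set Topology
open Literature.MathematicalPhysics.KineticTheory.HeatConduction
open Summit.AtomisticToContinuum.FouriersLaw.Theses.CoercivePulse (PulseCalculus)

set_option linter.unusedVariables false

/-! ## §1 The stub statements (named)

Notation of the docstrings (everything is INLINED in the statements, exactly as in the route file): Γ = the guard of
`PulseCalculus` (parameters, `T`, `μ` DLR + shift-invariant + momentum-reversal-invariant, `D` preserving `μ` with
`φ_t ∘ shift = shift ∘ φ_t` a.e.); `h_x(σ) = p_x²/2 + U(q_x) + ½[V(q_{x+1}−q_x) + V(q_x−q_{x−1})]`;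
`S(x,t) = ∫ (h_0 − ⟨h_0⟩)(h_x∘φ_t − ⟨h_0⟩) dμ`; `M(t) = Σ_x x² S(x,t)`; `C_T(t) = D.currentCorrelation μ t`. -/

/-- Statement of `stub_currentRegularity` (S1, the CURRENT side): under the guard Γ of the crux, the summed
current autocorrelation `C_T(t) = Σ_x ∫ j_0 · (j_x ∘ φ_t) dμ` converges absolutely at every `t`, is continuous in
`t`, and is bounded. -/
def Sig.stub_currentRegularity : Prop :=
    ∀ ω₂ lam β γ : ℝ, 0 < ω₂ → 0 < lam → 0 < β → ∀ T : ℝ, 0 < T →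
      ∀ μ : Measure ChainConfig, (pinnedChain ω₂ lam β γ).IsChainGibbsMeasure T μ →
        IsShiftInvariant μ → μ.map (fun σ : ChainConfig => fun x : ℤ => ((σ x).1, -(σ x).2)) = μ →
      ∀ D : InfiniteChainDynamics (pinnedChain ω₂ lam β γ), D.PreservesMeasure μ →
        (∀ t : ℝ, ∀ᵐ σ ∂μ, D.flow t (shift σ) = shift (D.flow t σ)) →
        (∀ t : ℝ, D.HasAbsConvergentCorrelation μ t) ∧
          Continuous (fun t : ℝ => D.currentCorrelation μ t) ∧
          ∃ B : ℝ, ∀ t : ℝ, |D.currentCorrelation μ t| ≤ B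

/-- Statement of `stub_pulseRegularity` (S2, the ENERGY side, load-bearing): under Γ, with the split-bond site
energy `h` and the pulse `S(x,t) = Cov(h_0, h_x ∘ φ_t)`, `Σ_x (1+x²)|S(x,t)| < ∞` at every `t` and the Helfand moment
`M(t) = Σ_x x² S(x,t)` is continuous. -/
def Sig.stub_pulseRegularity : Prop :=
    ∀ ω₂ lam β γ : ℝ, 0 < ω₂ → 0 < lam → 0 < β → ∀ T : ℝ, 0 < T →
      ∀ μ : Measure ChainConfig, (pinnedChain ω₂ lam β γ).IsChainGibbsMeasure T μ →
        IsShiftInvariant μ → μ.map (fun σ : ChainConfig => fun x : ℤ => ((σ x).1, -(σ x).2)) = μ →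
      ∀ D : InfiniteChainDynamics (pinnedChain ω₂ lam β γ), D.PreservesMeasure μ →
        (∀ t : ℝ, ∀ᵐ σ ∂μ, D.flow t (shift σ) = shift (D.flow t σ)) →
      ∀ h : ChainConfig → ℤ → ℝ, h = (fun (σ : ChainConfig) (x : ℤ) => (σ x).2 ^ 2 / 2 +
          (pinnedChain ω₂ lam β γ).U (σ x).1 + ((pinnedChain ω₂ lam β γ).V ((σ (x + 1)).1 - (σ x).1) +
            (pinnedChain ω₂ lam β γ).V ((σ x).1 - (σ (x - 1)).1)) / 2) →
      ∀ S : ℤ → ℝ → ℝ, S = (fun (x : ℤ) (t : ℝ) =>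
          ∫ σ, (h σ 0 - ∫ σ', h σ' 0 ∂μ) * (h (D.flow t σ) x - ∫ σ', h σ' 0 ∂μ) ∂μ) →
        (∀ t : ℝ, Summable (fun x : ℤ => (1 + (x : ℝ) ^ 2) * |S x t|)) ∧
          Continuous (fun t : ℝ => ∑' x : ℤ, (x : ℝ) ^ 2 * S x t)

/-- Statement of `stub_helfandIdentity` (S3, the IDENTITY): under Γ and GIVEN the regularity conclusions of S1 and
S2, Helfand's 'heat diffusion ⇔ current autocorrelation' identity in local (doubly integrated) form:
`M(t) − M(0) = 2 ∫₀ᵗ (t−u) C_T(u) du` for `t > 0`. -/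
def Sig.stub_helfandIdentity : Prop :=
    ∀ ω₂ lam β γ : ℝ, 0 < ω₂ → 0 < lam → 0 < β → ∀ T : ℝ, 0 < T →
      ∀ μ : Measure ChainConfig, (pinnedChain ω₂ lam β γ).IsChainGibbsMeasure T μ →
        IsShiftInvariant μ → μ.map (fun σ : ChainConfig => fun x : ℤ => ((σ x).1, -(σ x).2)) = μ →
      ∀ D : InfiniteChainDynamics (pinnedChain ω₂ lam β γ), D.PreservesMeasure μ →
        (∀ t : ℝ, ∀ᵐ σ ∂μ, D.flow t (shift σ) = shift (D.flow t σ)) →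
      ∀ h : ChainConfig → ℤ → ℝ, h = (fun (σ : ChainConfig) (x : ℤ) => (σ x).2 ^ 2 / 2 +
          (pinnedChain ω₂ lam β γ).U (σ x).1 + ((pinnedChain ω₂ lam β γ).V ((σ (x + 1)).1 - (σ x).1) +
            (pinnedChain ω₂ lam β γ).V ((σ x).1 - (σ (x - 1)).1)) / 2) →
      ∀ S : ℤ → ℝ → ℝ, S = (fun (x : ℤ) (t : ℝ) =>
          ∫ σ, (h σ 0 - ∫ σ', h σ' 0 ∂μ) * (h (D.flow t σ) x - ∫ σ', h σ' 0 ∂μ) ∂μ) →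
      (∀ t : ℝ, D.HasAbsConvergentCorrelation μ t) → Continuous (fun t : ℝ => D.currentCorrelation μ t) →
      (∃ B : ℝ, ∀ t : ℝ, |D.currentCorrelation μ t| ≤ B) →
      (∀ t : ℝ, Summable (fun x : ℤ => (1 + (x : ℝ) ^ 2) * |S x t|)) →
      Continuous (fun t : ℝ => ∑' x : ℤ, (x : ℝ) ^ 2 * S x t) →
      ∀ t : ℝ, 0 < t →
        (∑' x : ℤ, (x : ℝ) ^ 2 * S x t) - (∑' x : ℤ, (x : ℝ) ^ 2 * S x 0) =
          2 * ∫ u in Set.Ioc (0 : ℝ) t, (t - u) * D.currentCorrelation μ u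

/-! ## §2 The registered stubs (the only `sorry`s of the file) -/

/-- **S1 `stub_currentRegularity`** (size L; current-side clustering). For `pinnedChain ω₂ lam β γ`
(`ω₂, lam, β > 0`, any `γ`), `T > 0`, every shift- and momentum-reversal-invariant DLR Gibbs state `μ` and every
`μ`-preserving, a.e. shift-covariant infinite-volume dynamics `D`: (i) `D.HasAbsConvergentCorrelation μ t` for
every `t` (each `j_0 · (j_x ∘ φ_t)` integrable, `Σ_x |∫ j_0 (j_x∘φ_t) dμ| < ∞`); (ii) `t ↦ C_T(t)` is continuous;
(iii) `|C_T(t)| ≤ B` for all `t`. Why plausibly true: `j_x` is a local polynomial observable, in `L²(μ)` by the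
superstability estimate of the 1-D Gibbs state; spatial sum converges by exponential transfer-operator mixing of
the 1-D DLR state composed with the fixed-time `L²` light-cone locality of the superstable flow (`ℓ¹` space–time
clustering); in the zero-wavenumber Hilbert space `C_T(t) = ⟨J, U_t J⟩` for the unitary Koopman group, so
`|C_T(t)| ≤ C_T(0)`-type bounds and continuity follow from strong continuity (orbits are `C¹` in `t`, dominated
convergence, density). IN TREE for the CANONICAL Buttà–Marchioro pair (carrier `bmGood`):
`Theorems.MourreDissolution.stub_gibbsClustering` (landed, Theorems/EmbeddedDrudeMourreMourreDissolutionGibbsClustering.lean)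
+ `ZeroWavenumberData.hasAbsConvergentCorrelation`, `…integrableOn_exp_neg_mul_currentCorrelation`
(Literature/…/ZeroWavenumberSpace.lean, FluctuationAbelPositivity.lean); what is NOT in tree is the guard's
generality (EVERY symmetric DLR `μ` and EVERY `μ`-preserving a.e.-covariant `D`; 1-D DLR uniqueness
`InfiniteChainDLRUniqueness` identifies `μ`, not `D`). Why it might fail: only as typed — a non-tempered DLR state
or an exotic `μ`-preserving flow outside the Lanford–Lebowitz–Lieb uniqueness class (the crux's own guard caveat).
[LanfordLebowitzLieb1977 Thm 3; ButtaMarchioro2016 Thm 2.1–2.2; BonettoLebowitzReyBellet2000 §7 (37); Georgii2011 Ch. 8] -/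
theorem stub_currentRegularity :
    ∀ ω₂ lam β γ : ℝ, 0 < ω₂ → 0 < lam → 0 < β → ∀ T : ℝ, 0 < T →
      ∀ μ : Measure ChainConfig, (pinnedChain ω₂ lam β γ).IsChainGibbsMeasure T μ →
        IsShiftInvariant μ → μ.map (fun σ : ChainConfig => fun x : ℤ => ((σ x).1, -(σ x).2)) = μ →
      ∀ D : InfiniteChainDynamics (pinnedChain ω₂ lam β γ), D.PreservesMeasure μ →
        (∀ t : ℝ, ∀ᵐ σ ∂μ, D.flow t (shift σ) = shift (D.flow t σ)) →
        (∀ t : ℝ, D.HasAbsConvergentCorrelation μ t) ∧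
          Continuous (fun t : ℝ => D.currentCorrelation μ t) ∧
          ∃ B : ℝ, ∀ t : ℝ, |D.currentCorrelation μ t| ≤ B := by
  sorry

/-- **S2 `stub_pulseRegularity`** (size L–XL; LOAD-BEARING — the part the grounders found proved nowhere). Same
guard, with `h` the split-bond site energy `energyDensityZ` (spelled out) and `S(x,t) = Cov_μ(h_0, h_x ∘ φ_t)`:
(i) `Σ_x (1 + x²) |S(x,t)| < ∞` at every `t` — fixed-time spatial decay of the energy–energy correlation with
weight `x²`: exponential clustering of the 1-D Gibbs state (transfer operator `e^{−U/2T}e^{−V/T}e^{−U/2T}`,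
Hilbert–Schmidt) composed with a light-cone bound for the `deg V′ = 3` infinite dynamics carrying TWO spatial
moments (the tree's `exists_summable_l2_locality`, Literature/…/InfiniteChainL2Locality.lean:74, gives only a
summable rate `ε_n`, no `Σ n² ε_n`; Buttà–Marchioro's almost-linear `t log^α t` propagation bound should give
every polynomial moment); (ii) continuity of `M(t) = Σ_x x² S(x,t)` (locally uniform weighted domination +
continuity of each `S(x,·)` by dominated convergence along `C¹` orbits). Calibration: at `lam = β = 0` the pulse is
an explicit Bessel-type kernel with `M ≈ 0.19 t²` — (i),(ii) HOLD there (ballistic but finite moments), so this stub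
does not separate the harmonic member (the route's envelopes do). Why it might fail: a light-cone estimate with
polynomial spatial weights for the quartic (unbounded-frequency) infinite dynamics in Gibbs mean is not printed;
fast energetic excursions make the sup-norm Lieb–Robinson bound false and only averaged bounds can hold.
[ButtaMarchioro2016 §2–3; ButtaEtAl2007 Thm 2.2; MarchioroPellegrinottiPulvirenti1978; LanfordLebowitzLieb1977 §4;
arXiv:1103.2835 §II] -/
theorem stub_pulseRegularity :
    ∀ ω₂ lam β γ : ℝ, 0 < ω₂ → 0 < lam → 0 < β → ∀ T : ℝ, 0 < T →
      ∀ μ : Measure ChainConfig, (pinnedChain ω₂ lam β γ).IsChainGibbsMeasure T μ →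
        IsShiftInvariant μ → μ.map (fun σ : ChainConfig => fun x : ℤ => ((σ x).1, -(σ x).2)) = μ →
      ∀ D : InfiniteChainDynamics (pinnedChain ω₂ lam β γ), D.PreservesMeasure μ →
        (∀ t : ℝ, ∀ᵐ σ ∂μ, D.flow t (shift σ) = shift (D.flow t σ)) →
      ∀ h : ChainConfig → ℤ → ℝ, h = (fun (σ : ChainConfig) (x : ℤ) => (σ x).2 ^ 2 / 2 +
          (pinnedChain ω₂ lam β γ).U (σ x).1 + ((pinnedChain ω₂ lam β γ).V ((σ (x + 1)).1 - (σ x).1) +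
            (pinnedChain ω₂ lam β γ).V ((σ x).1 - (σ (x - 1)).1)) / 2) →
      ∀ S : ℤ → ℝ → ℝ, S = (fun (x : ℤ) (t : ℝ) =>
          ∫ σ, (h σ 0 - ∫ σ', h σ' 0 ∂μ) * (h (D.flow t σ) x - ∫ σ', h σ' 0 ∂μ) ∂μ) →
        (∀ t : ℝ, Summable (fun x : ℤ => (1 + (x : ℝ) ^ 2) * |S x t|)) ∧
          Continuous (fun t : ℝ => ∑' x : ℤ, (x : ℝ) ^ 2 * S x t) := by
  sorry

/-- **S3 `stub_helfandIdentity`** (size L; the sum/derivative exchanges). Same guard; ASSUMING the conclusions of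
S1 (absolutely convergent, continuous, bounded `C_T`) and S2 (weighted summability of `S`, continuity of `M`), the
Einstein–Helfand identity in doubly-integrated form: for `t > 0`,
`M(t) − M(0) = 2 ∫_{(0,t]} (t − u) C_T(u) du`.
Mechanism: `Ṡ(x,t) = F(x−1,t) − F(x,t)` with the response current `F(x,t) = Cov(h_0, j_x∘φ_t)` from the local
conservation law `ḣ_x = j_{x−1} − j_x` (tree: `IsSolution.hasDerivAt_energyDensityZ`) differentiated under `∫ dμ`
(moment bounds); summation by parts `M′ = Σ_x (2x+1) F(x,t)` (needs `Σ(1+|x|)|F| < ∞`, part of the prover's burden);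
stationarity + `ḣ_0 = j_{−1} − j_0` + shift covariance of the flow (`hShift`, tree: `flow_chainShift`,
`bondCurrentZ_comp_chainShift`) give `Ḟ(x,t) = G(x,t) − G(x+1,t)`, `G(x,t) = ∫ j_0 (j_x∘φ_t) dμ`, hence
`M″ = 2 Σ_x G(x,t) = 2 C_T(t)`; momentum reversal (`hRefl`: `h` even, `j` odd in `p`) gives `∫ j_x dμ = 0` (so `G`
is a covariance) and `M′(0) = Σ(2x+1)Cov(h_0, j_x) = 0`; integrate twice. Printed formally: Helfand 1960;
Lukkarinen LNP 921 (4.52)–(4.58); Liu–Hänggi–Li–Ren–Li arXiv:1103.2835 eq. (4)–(8) (`d²⟨Δx²(t)⟩_E/dt² = 2C_JJ(t)/(k_BT²c)`);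
finite-volume ancestor Gaspard 1998 §6.5.2 (6.76). Why it might fail: only through the exchanges — time-derivatives
under `Σ_x` and `∫ dμ` need locally-uniform weighted bounds slightly beyond S1/S2's conclusions (the prover must
re-derive them from Γ; S1/S2 are given as hypotheses to fix the target, not as the only input).
[Helfand1960; arXiv:1103.2835; BonettoLebowitzReyBellet2000 §5.2 (23), §7; Bernardin2014 §1.1] -/
theorem stub_helfandIdentity :
    ∀ ω₂ lam β γ : ℝ, 0 < ω₂ → 0 < lam → 0 < β → ∀ T : ℝ, 0 < T →
      ∀ μ : Measure ChainConfig, (pinnedChain ω₂ lam β γ).IsChainGibbsMeasure T μ →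
        IsShiftInvariant μ → μ.map (fun σ : ChainConfig => fun x : ℤ => ((σ x).1, -(σ x).2)) = μ →
      ∀ D : InfiniteChainDynamics (pinnedChain ω₂ lam β γ), D.PreservesMeasure μ →
        (∀ t : ℝ, ∀ᵐ σ ∂μ, D.flow t (shift σ) = shift (D.flow t σ)) →
      ∀ h : ChainConfig → ℤ → ℝ, h = (fun (σ : ChainConfig) (x : ℤ) => (σ x).2 ^ 2 / 2 +
          (pinnedChain ω₂ lam β γ).U (σ x).1 + ((pinnedChain ω₂ lam β γ).V ((σ (x + 1)).1 - (σ x).1) +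
            (pinnedChain ω₂ lam β γ).V ((σ x).1 - (σ (x - 1)).1)) / 2) →
      ∀ S : ℤ → ℝ → ℝ, S = (fun (x : ℤ) (t : ℝ) =>
          ∫ σ, (h σ 0 - ∫ σ', h σ' 0 ∂μ) * (h (D.flow t σ) x - ∫ σ', h σ' 0 ∂μ) ∂μ) →
      (∀ t : ℝ, D.HasAbsConvergentCorrelation μ t) → Continuous (fun t : ℝ => D.currentCorrelation μ t) →
      (∃ B : ℝ, ∀ t : ℝ, |D.currentCorrelation μ t| ≤ B) →
      (∀ t : ℝ, Summable (fun x : ℤ => (1 + (x : ℝ) ^ 2) * |S x t|)) →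
      Continuous (fun t : ℝ => ∑' x : ℤ, (x : ℝ) ^ 2 * S x t) →
      ∀ t : ℝ, 0 < t →
        (∑' x : ℤ, (x : ℝ) ^ 2 * S x t) - (∑' x : ℤ, (x : ℝ) ^ 2 * S x 0) =
          2 * ∫ u in Set.Ioc (0 : ℝ) t, (t - u) * D.currentCorrelation μ u := by
  sorry

/-! ### Consistency: each named statement IS its stub's type (definitionally) -/

example : Sig.stub_currentRegularity := stub_currentRegularity
example : Sig.stub_pulseRegularity := stub_pulseRegularity
example : Sig.stub_helfandIdentity := stub_helfandIdentity

/-! ## §3 The glue (real analysis, fully proved) -/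

/-- GLUE (proved): a measurable bounded `C` has `e^{−νt} C(t) ∈ L¹(0,∞)` for every `ν > 0` (conjunct (2) of the crux
from S1). [folklore] -/
theorem integrableOn_exp_neg_mul_of_bounded {C : ℝ → ℝ} {B : ℝ} (hC : Measurable C) (hB : ∀ t, |C t| ≤ B)
    {ν : ℝ} (hν : 0 < ν) :
    IntegrableOn (fun t : ℝ => Real.exp (-(ν * t)) * C t) (Ioi 0) := by
  refine Integrable.mono' (g := fun t => |B| * Real.exp (-ν * t))
    ((exp_neg_integrableOn_Ioi 0 hν).const_mul |B|) ?_ (ae_of_all _ fun t => ?_)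
  · exact ((Real.continuous_exp.measurable.comp ((measurable_const.mul measurable_id).neg)).mul hC).aestronglyMeasurable
  · rw [norm_mul, Real.norm_eq_abs, Real.norm_eq_abs, abs_of_pos (Real.exp_pos _), neg_mul, mul_comm]
    exact mul_le_mul_of_nonneg_right ((hB t).trans (le_abs_self B)) (Real.exp_pos _).le

/-- GLUE (proved): the LAPLACE FORM of Helfand's identity from its LOCAL form. If `C` is measurable and bounded and
`M(t) − M(0) = 2∫_{(0,t]}(t−u)C(u)du` for `t > 0`, then for every `ν > 0`, `e^{−νt}(M(t)−M(0)) ∈ L¹(0,∞)` and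
`∫₀^∞ e^{−νt} C = (ν²/2) ∫₀^∞ e^{−νt}(M(t)−M(0))` — conjunct (5) of the crux from S1 + S3, via the landed Fubini-on-the-
triangle theorem `laplace_doubleIntegral` (`ν² ∫ e^{−νt} V = ∫ e^{−νt} C`, `V(t) = ∫₀ᵗ(t−u)C`). [folklore] -/
theorem laplace_of_helfand {C M : ℝ → ℝ} {B : ℝ} (hC : Measurable C) (hB : ∀ t, |C t| ≤ B)
    (hloc : ∀ t : ℝ, 0 < t → M t - M 0 = 2 * ∫ u in Set.Ioc (0 : ℝ) t, (t - u) * C u)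
    {ν : ℝ} (hν : 0 < ν) :
    IntegrableOn (fun t : ℝ => Real.exp (-(ν * t)) * (M t - M 0)) (Ioi 0) ∧
      ∫ t in Set.Ioi (0 : ℝ), Real.exp (-(ν * t)) * C t =
        ν ^ 2 / 2 * ∫ t in Set.Ioi (0 : ℝ), Real.exp (-(ν * t)) * (M t - M 0) := by
  obtain ⟨hi, heq⟩ :=
    Summit.AtomisticToContinuum.FouriersLaw.Theorems.AbelThermodynamicLimit.LoomisCompactHorizonWitness.laplace_doubleIntegral
      hC hB hν
  have hpt : ∀ t ∈ Ioi (0 : ℝ), Real.exp (-(ν * t)) * (M t - M 0) =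
      2 * (Real.exp (-(ν * t)) * ∫ u in Set.Ioc (0 : ℝ) t, (t - u) * C u) := fun t ht => by
    rw [hloc t ht]; ring
  refine ⟨IntegrableOn.congr_fun (hi.const_mul 2) (fun t ht => (hpt t ht).symm) measurableSet_Ioi, ?_⟩
  rw [setIntegral_congr_fun measurableSet_Ioi hpt, integral_const_mul, ← heq]
  ring

/-! ## §4 The kernel-checked composition -/

/-- **Composition `PulseCalculus_of`** (sorry-free): S1 → S2 → S3 → `PulseCalculus`, hypotheses = the declared stubs
BY NAME (`Sig.stub_*`), conclusion = the route decl BY NAME. Proof: fix the guarded data; S1 gives (1) and a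
continuous bounded `C_T`, whence (2) (`integrableOn_exp_neg_mul_of_bounded`); S2 gives (3),(4); S3 fed with S1's and
S2's conclusions gives the local Helfand identity, whence (5) (`laplace_of_helfand`). -/
theorem PulseCalculus_of :
    Sig.stub_currentRegularity → Sig.stub_pulseRegularity → Sig.stub_helfandIdentity → PulseCalculus := by
  intro h1 h2 h3 ω₂ lam β γ hω hl hβ T hT μ hG hSI hRefl D hP hShift h hh S hS
  obtain ⟨hAC, hcont, hbdd⟩ := h1 ω₂ lam β γ hω hl hβ T hT μ hG hSI hRefl D hP hShift
  obtain ⟨hSum, hM⟩ := h2 ω₂ lam β γ hω hl hβ T hT μ hG hSI hRefl D hP hShift h hh S hS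
  have hloc := h3 ω₂ lam β γ hω hl hβ T hT μ hG hSI hRefl D hP hShift h hh S hS hAC hcont hbdd hSum hM
  obtain ⟨B, hB⟩ := hbdd
  have hmeas : Measurable (D.currentCorrelation μ) := hcont.measurable
  refine ⟨hAC, fun ν hν => integrableOn_exp_neg_mul_of_bounded hmeas hB hν, hSum, hM, fun ν hν => ?_⟩
  exact laplace_of_helfand (M := fun t => ∑' x : ℤ, (x : ℝ) ^ 2 * S x t) hmeas hB hloc hν

/-! ## §5 Instantiation through the sorried stubs (an `example`: registers nothing and leaves `PulseCalculus_of`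
the unique declaration concluding the crux) -/

example : PulseCalculus := PulseCalculus_of stub_currentRegularity stub_pulseRegularity stub_helfandIdentity

end Summit.AtomisticToContinuum.FouriersLaw.Cruxes.PulseCalculus.Birth
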